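import Summits.CriticalPhenomena.PercolationContinuityZ3.Theses.PercFiniteBoxLRO
import Summits.CriticalPhenomena.PercolationContinuityZ3.Theorems.PercNearOneGluingNoHeavyLowerTailCSHTheoremOne
import Literature.Probability.Percolation.CriticalTwoArmsPersistence
import Literature.Probability.Percolation.StaticRenormalizationTwoArms
import Literature.Probability.Percolation.StaticRenormalizationBlocks
import Literature.Probability.Percolation.StaticRenormalizationBoxes
import Literature.Probability.Percolation.StaticRenormalizationSlabs
import Literature.Probability.Percolation.SharpnessDCTProofs
import Literature.Probability.Percolation.BernoulliPercolationProofs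
import Literature.Probability.Percolation.PlanarDuality
import Literature.Probability.Percolation.InequalitiesProofs
import Literature.Probability.Percolation.PercolationProofs
import Literature.Probability.Percolation.ConnectivityProofs
import Literature.Probability.Percolation.PercolationEvents
import HarnessLib

/-!
# `PercFiniteBoxLRO.LinearScaleLROOfTheta` (stmt-CriticalPhenomena-0855) — SETTLED after continuity

Item `stmt-CriticalPhenomena-0855` of route `CriticalPhenomena/PercFiniteBoxLRO` (crux (rank 2)): linear-scale finite-box long-range order from positive density: if `θ(p) > 0` then for some `ρ > 0` and `K`, `P_p(x ↔ y inside Λ_{Kn}) ≥ ρ` for all `n ≥ 1` and `x, y ∈ Λ_n`.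

With `θ(p_c(ℤ³)) = 0` (p205010) every percolating `p` is strictly supercritical, where Grimmett's static renormalisation is available in the tree: Lemma (7.78) (`exists_slabConn`) feeds Lemma (7.89) (`real_twoArm_le_pow`: the two-arm event `A_R(x,y) = {x ↔ ∂Λ_R, y ↔ ∂Λ_R, x ↮ y in Λ_{R−1}}` has probability `≤ (1−η)^K` at `R = n + 1 + K(2k+1)` for `x, y ∈ Λ_n`).  On lattice configurations `{x ↔ ∞} ∩ {y ↔ ∞} ⊆ A_R(x,y) ∪ {x ↔ y in Λ_{R−1}}`, so Harris' inequality gives `θ(p)² ≤ (1−η)^{K₀} + P_p(x ↔ y in Λ_{Kn})` with `K = K₀(2k+1) + 1`, `(1−η)^{K₀} < θ(p)²/2`: `ρ = θ(p)²/2` works at EVERY `n ≥ 1`.  The item's note ('p > p_c: Grimmett–Marstrand, heavy, not in tree') predates the Literature's `StaticRenormalization*` files.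

builds on p205010 (kernel theorem, internal audit signed; external expert review pending) — USED (`CSH.percolationContinuityZ3_holds`).  RSW3 lane, lead gen 28 (prover-prim-rsw3-lead-g28-0):
'after continuity — the ledger harvest'.
References: G. Kozma, N. Nitzan (2024), Thm. 6 / Conj. 3 [KozmaNitzan2024]; G. Grimmett, *Percolation* (1999), §8 [GrimmettPercolation1999].
-/

noncomputable section

namespace Summit.CriticalPhenomena.PercolationContinuityZ3.Theorems

namespace PercFiniteBoxLROLinearScaleLROOfTheta

open MeasureTheory Literature.Probability.Percolation Literature.Probability.LatticeModels
open DCT16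

/-- **`PercFiniteBoxLRO.LinearScaleLROOfTheta` (stmt-CriticalPhenomena-0855), settled.**  `ρ = θ(p)²/2`, `K = K₀(2k+1)+1`: Harris + Grimmett Lemmas (7.78)/(7.89) at `p > p_c` (p205010).
[cite: KozmaNitzan2024, Thm. 6 with Conj. 3 (p. 15)] -/
theorem linearScaleLROOfTheta_proof : Summit.CriticalPhenomena.PercolationContinuityZ3.Theses.PercFiniteBoxLRO.LinearScaleLROOfTheta := by
  classical
  intro p hθ
  have h0 : theta (zdGraph 3) (0 : Site 3) (criticalProbI 3) = 0 := CSH.percolationContinuityZ3_holds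
  -- (1) every percolating parameter is strictly supercritical
  have hp : criticalProb (zdGraph 3) (0 : Site 3) < (p : ℝ) := by
    have hle := KestenZhang.criticalProb_le_of_theta_pos_zd hθ
    rcases hle.eq_or_lt with heq | hlt
    · exfalso
      have hp' : p = criticalProbI 3 := Subtype.ext (by rw [coe_criticalProbI]; exact heq.symm)
      rw [hp', h0] at hθ
      exact lt_irrefl _ hθ
    · exact hlt
  -- (2) Grimmett's Lemma (7.78) at `p`: slab connections
  obtain ⟨k, hk1, δ, hδ, hslab⟩ := exists_slabConn (d := 3) le_rfl p hp
  set δ₁ : ℝ := min δ 1 with hδ₁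
  have hδ₁0 : 0 < δ₁ := lt_min hδ one_pos
  have hδ₁le : δ₁ ≤ δ := min_le_left _ _
  have hδ₁one : δ₁ ≤ 1 := min_le_right _ _
  obtain ⟨η, hηdef⟩ : ∃ η : ℝ, η = δ₁ ^ 5 := ⟨_, rfl⟩
  have hη0 : 0 < η := by rw [hηdef]; positivity
  have hηone : η ≤ 1 := by rw [hηdef]; exact pow_le_one₀ hδ₁0.le hδ₁one
  have hslab' : ∀ R : ℕ, k ≤ R → ∀ (j : Fin 3) (s : Bool), ∀ x ∈ slice R k j s, ∀ y ∈ slice R k j s,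
      δ₁ ≤ (bondPercolation (zdGraph 3) p).real (inConn (slice R k j s) x y) :=
    fun R hR j s x hx y hy => hδ₁le.trans (hslab R hR j s x hx y hy)
  -- (3) Grimmett's Lemma (7.89) at `p`: the two-arm event decays geometrically in the number of shells
  have h789 : ∀ (n : ℕ) (x y : Site 3), x ∈ box 3 n → y ∈ box 3 n →
      ∀ K : ℕ, (bondPercolation (zdGraph 3) p).real (twoArm (n + 1 + K * (2 * k + 1)) x y) ≤ (1 - η) ^ K := by
    intro n x y hx hy K
    refine real_twoArm_le_pow (k := k) (p := p) (η := η) hηone (fun R hR u v hu hv => ?_) n hx hy K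
    obtain ⟨ju, su, hu⟩ := hu
    obtain ⟨jv, sv, hv⟩ := hv
    calc η = δ₁ ^ 5 := hηdef
      _ = δ₁ ^ (3 + 2) := by norm_num
      _ ≤ _ := le_real_inConn_cubeShell (by norm_num) hδ₁0.le hδ₁one (hslab' (R + 2 * k) (by omega)) hu hv
  -- (4) the number of shells `K₀` with `(1 - η)^{K₀} < θ(p)²/2`, and the constants
  set θp : ℝ := theta (zdGraph 3) (0 : Site 3) p with hθp
  have hθ2 : 0 < θp ^ 2 / 2 := by positivity
  obtain ⟨K₀, hK₀⟩ := exists_pow_lt_of_lt_one hθ2 (show 1 - η < 1 by linarith)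
  refine ⟨θp ^ 2 / 2, hθ2, K₀ * (2 * k + 1) + 1, fun n hn x hx y hy => ?_⟩
  set R : ℕ := n + 1 + K₀ * (2 * k + 1) with hR
  have hA : K₀ * (2 * k + 1) ≤ K₀ * (2 * k + 1) * n := Nat.le_mul_of_pos_right _ hn
  have hRK : R - 1 ≤ (K₀ * (2 * k + 1) + 1) * n :=
    calc R - 1 = K₀ * (2 * k + 1) + n := by rw [hR]; omega
      _ ≤ K₀ * (2 * k + 1) * n + n := Nat.add_le_add_right hA n
      _ = (K₀ * (2 * k + 1) + 1) * n := by ring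
  have hnR : n ≤ R - 1 := by rw [hR]; omega
  have hx' : x ∈ (↑(box 3 (R - 1)) : Set (Site 3)) := Finset.mem_coe.2 (box_mono 3 hnR hx)
  have hy' : y ∈ (↑(box 3 (R - 1)) : Set (Site 3)) := Finset.mem_coe.2 (box_mono 3 hnR hy)
  have hsub : (↑(box 3 (R - 1)) : Set (Site 3)) ⊆ ↑(box 3 ((K₀ * (2 * k + 1) + 1) * n)) :=
    Finset.coe_subset.2 (box_mono 3 hRK)
  -- (5) on lattice configurations: two infinite clusters at `x`, `y` give the two-arm event unless `x ↔ y` inside `Λ_{R-1}`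
  have hcover : ∀ ω : BondConfig (Site 3), ω ⊆ (zdGraph 3).edgeSet →
      ω ∈ (percolatesAt x ∩ percolatesAt y : Set (BondConfig (Site 3))) →
      ω ∈ twoArm R x y ∪ openConnIn (↑(box 3 ((K₀ * (2 * k + 1) + 1) * n)) : Set (Site 3)) x y := by
    intro ω hω hxy
    obtain ⟨hpx, hpy⟩ := hxy
    by_cases hin : ω ∈ inConn (↑(box 3 (R - 1)) : Set (Site 3)) x y
    · right
      obtain ⟨W, hWs, hWe⟩ := exists_walk_of_mem_inConn (hsub hx') (inConn_mono hsub x y hin)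
      exact mem_openConnIn_of_walk W hWs hWe
    · left
      refine ⟨⟨boxArm_of_not_subset hω hx' fun h => hpx ((box 3 (R - 1)).finite_toSet.subset h),
        boxArm_of_not_subset hω hy' fun h => hpy ((box 3 (R - 1)).finite_toSet.subset h)⟩, hin⟩
  -- (6) Harris: θ(p)² ≤ P(x ⟷ ∞, y ⟷ ∞); union bound; Lemma (7.89)
  have hH := harris_fkg_holds (zdGraph 3) p (isUpperSet_percolatesAt x) (isUpperSet_percolatesAt y)
    (measurableSet_percolatesAt_holds x) (measurableSet_percolatesAt_holds y)
  rw [show (bondPercolation (zdGraph 3) p).real (percolatesAt x) = theta (zdGraph 3) x p from rfl,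
    show (bondPercolation (zdGraph 3) p).real (percolatesAt y) = theta (zdGraph 3) y p from rfl,
    theta_zdGraph_eq_theta_zero p x, theta_zdGraph_eq_theta_zero p y] at hH
  have h2 : (bondPercolation (zdGraph 3) p).real (percolatesAt x ∩ percolatesAt y) ≤
      (bondPercolation (zdGraph 3) p).real (twoArm R x y) +
        (bondPercolation (zdGraph 3) p).real (openConnIn (↑(box 3 ((K₀ * (2 * k + 1) + 1) * n)) : Set (Site 3)) x y) :=
    (real_mono_of_forall_subset_edgeSet (zdGraph 3) p hcover).trans (measureReal_union_le _ _)
  have h3 : (bondPercolation (zdGraph 3) p).real (twoArm R x y) ≤ (1 - η) ^ K₀ := h789 n x y hx hy K₀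
  nlinarith [hH, h2, h3, hK₀]

end PercFiniteBoxLROLinearScaleLROOfTheta

end Summit.CriticalPhenomena.PercolationContinuityZ3.Theorems

end
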